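import Summits.QuantumFields.BalabanUV.Beta.FP.PerfectSecondOrderTablesInf
import Summits.QuantumFields.BalabanUV.Beta.FP.CompositeAveragingTablesMixedLetters
import Summits.QuantumFields.BalabanUV.Beta.DshAn1Spread

/-!
# `BalabanUV.Beta.FP.PerfectSecondOrderTablesLetters` — road «FP» for binder row D1, row **N1-J∞-W PART 3(b)**, FILE D5 of the part: THE LETTERS OF THE RECORD —
# FILE D2's composite tables of the (0.4) literal at the limit, `MCompInf tabs cΛ m` and `M2CompInf tabs cΛ m`, ARE a first-order vertex family ∕ a local field–multiplier
# table at blocking `Lc^m`, UNCONDITIONALLY in an2's `SymTables` letters (FILES D3 ∕ D4 fed with the decay of the one-step weight of record `qSym Lc` — finite range, every rate)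

HONEST DEPENDENCY (page 1, mandatory): continuum YM on T⁴ ⇐ BetaPertH ∧ nine spine estimates (0/9 proved); BetaPertH ⇐ (D1) ∧ (D4) ∧ CAP+tail;
G-an2-4 gates asym, D1 and NE2/3/4.  HONEST FRAMING (cell contract, verbatim): «discharging `BetaPertH` makes Bałaban's UV stability UNCONDITIONAL —
a real constructive-QFT result; it is NOT the continuum limit and NOT the Clay problem.»  ABSOLUTE RULE (cell charter, verbatim): «No internally-minted
statement may enter as a cited fact. Every hypothesis is either kernel-proved in this package or a verbatim quotation of a PUBLISHED theorem with page
reference. The manuscript(s) under audit are NOT citable for their own disputed steps — they are the thing under adjudication; programme-internal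
(2001/route/tribunal) claims are never citable.»  THIS MODULE is [folklore] kernel bookkeeping (no `def`, no `def … : Prop`, nothing cited, 0 sorry) about OUR typed objects
(`qSym`, `MCompInf`, `M2CompInf` of FILE D2; `SymTables` of an2).  0∕4 row-D1 binders; NOT X1m, NOT (STEP), NOT D1, NOT BetaPertH, NOT continuum, NOT Clay.  «not in print; our bookkeeping».

WHY.  The END's `m ≥ 2` split ∕ extra-slot rows read FILE D2's carrier `WtInf G tabs cΛ S∞ S₂∞ m = W2SymOfK (G m) (Lc^m) S∞ (MCompInf tabs cΛ m) S₂∞ (M2CompInf tabs cΛ m)` through an2's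
`vertexFamily₂`-lemmas, which consume exactly `VertexFamily (MCompInf … m) (Lc^m) _ _` and `LocStencilFM (Lc^m) (M2CompInf … m) _ _`.  FILES D3 ∕ D4 prove these for the GENERIC
composites from three letters (Lq), (LH), (LM); this file discharges the three letters for the RECORD: (Lq) for `qSym Lc` from `qSym_eq_border` and an1∕an2's finite-range decay of the
bordered Hessian of record (`BorderedHessian.decays_bhK`, `DshAn1.decays_Dsh`, every rate); (LH) = `tabs.hH` (every rate); (LM) = `tabs.hmix` (its rate is the one matched).

CONTENT ([folklore]; generic `d`, `Lc` with `NeZero Lc`).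
* `abs_qSym_le` — (Lq) OF RECORD AT EVERY RATE: `|qSym Lc ρ w κ u| ≤ (cBH d Lc + cDsh d Lc)·e^{δ(d+1)2Lc}·e^{−δ|u − Lc•w|₁}` (`δ ≥ 0`).
* **`vertexFamily_MCompInf`**: `∀ m, ∃ C δ′, 0 < δ′ ∧ VertexFamily (MCompInf tabs cΛ (m+1)) (Lc^(m+1)) C δ′` (FILE D3's `vertexFamily_HComp` at rate 1, `biLoc_smul`).
* **`locStencilFM_M2CompInf`**: `∀ m, ∃ C δ′, 0 < δ′ ∧ LocStencilFM (Lc^(m+1)) (M2CompInf tabs cΛ (m+1)) C δ′` (FILE D4's `locStencilFM_M2Comp` at the rate of `tabs.hmix`).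
Provenance: D1 formalisation swarm LEAF PROVER 02, unit b2b-balaban-beta-d1-formalise-leaf-02 gen 13, 2026-08-21 (R-FP-44 (B)).  No existing file touched.
-/

noncomputable section

namespace Summit.QuantumFields.BalabanUV.Beta.FP.PerfectSecondOrderTablesLetters

open Literature.MathematicalPhysics.QuantumFieldTheory
open Literature.MathematicalPhysics.QuantumFieldTheory.Balaban1983to89
open Literature.MathematicalPhysics.QuantumFieldTheory.Balaban1983to89.Beta
open B12Sec2to5 (l1)
open ExpKernelCalculus (MKer VertexFamily l1_sub_symm)
open AffineAveraging (Site)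
open OneStepResolventKernel (Fib)
open SecondOrderResponse (LocStencilFM biLoc_smul)
open Summit.QuantumFields.BalabanUV.Beta.BorderedHessian (bhK cBH cBH_nonneg decays_bhK)
open Summit.QuantumFields.BalabanUV.Beta.DshAn1 (Dsh cDsh cDsh_nonneg decays_Dsh)
open Summit.QuantumFields.BalabanUV.Beta.SymmetrisedStepJets (SymTables)
open Summit.QuantumFields.BalabanUV.Beta.FP.CompositeAveragingTablesInf (HComp M2Comp)
open Summit.QuantumFields.BalabanUV.Beta.FP.PerfectSecondOrderTablesInf (qSym qSym_eq_border lamPerfect MCompInf M2CompInf)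
open Summit.QuantumFields.BalabanUV.Beta.FP.CompositeAveragingTablesLetters (vertexFamily_HComp)
open Summit.QuantumFields.BalabanUV.Beta.FP.CompositeAveragingTablesMixedLetters (locStencilFM_M2Comp)

variable {d : ℕ} {Lc : ℕ} [NeZero Lc]

/-- [folklore] **(Lq) OF RECORD, AT EVERY RATE**: the one-step linearised (0.4) weight `qSym Lc` reads the fine bond `(κ, u)` in an exponential window around its coarse point `Lc•w`:
`|qSym Lc ρ w κ u| ≤ (cBH d Lc + cDsh d Lc)·e^{δ(d+1)2Lc}·e^{−δ|u − Lc•w|₁}` for every `δ ≥ 0` (it is the multiplier–field entry of the bordered Hessian of record `bhK Lc + Dsh Lc` at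
`(Lc•w, u)` — FILE D2's `qSym_eq_border` — whose two summands have finite range: `decays_bhK`, `decays_Dsh`). -/
theorem abs_qSym_le {δ : ℝ} (hδ : 0 ≤ δ) (ρ : Fin (d + 1)) (w : Site (d + 1)) (κ : Fin (d + 1)) (u : Site (d + 1)) :
    |qSym Lc ρ w κ u| ≤ (cBH d Lc + cDsh d Lc) * Real.exp (δ * (((d : ℝ) + 1) * (2 * Lc))) * Real.exp (-δ * l1 (u - (Lc : ℤ) • w)) := by
  have hLc : 1 ≤ Lc := Nat.one_le_iff_ne_zero.mpr (NeZero.ne Lc)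
  rw [qSym_eq_border, l1_sub_symm]
  have h1 := decays_bhK (d := d) hLc hδ ((Lc : ℤ) • w) u (Sum.inr ρ) (Sum.inl κ)
  have h2 := decays_Dsh (d := d) hLc hδ ((Lc : ℤ) • w) u (Sum.inr ρ) (Sum.inl κ)
  rw [show (bhK Lc + Dsh Lc : MKer (d + 1) (Fib d)) ((Lc : ℤ) • w) u (Sum.inr ρ) (Sum.inl κ)
      = bhK Lc ((Lc : ℤ) • w) u (Sum.inr ρ) (Sum.inl κ) + Dsh Lc ((Lc : ℤ) • w) u (Sum.inr ρ) (Sum.inl κ) from rfl]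
  refine (abs_add_le _ _).trans ((add_le_add h1 h2).trans (le_of_eq ?_))
  ring

/-- [our object — bookkeeping] **THE RECORD'S COMPOSITE MULTIPLIER TABLES ARE VERTEX FAMILIES AT THEIR OWN BLOCKING, UNCONDITIONALLY**: for an2's `SymTables` and every `cΛ`, `m`,
`∃ C δ′, 0 < δ′ ∧ VertexFamily (MCompInf tabs cΛ (m+1)) (Lc^(m+1)) C δ′` (FILE D3's `vertexFamily_HComp` fed with `abs_qSym_le` and `tabs.hH` at rate `1`, then `biLoc_smul cΛ`).
Discharges nothing of the END by itself (it is the (M)-letter its `m ≥ 2` rows will ask of `WtInf`). -/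
theorem vertexFamily_MCompInf (tabs : SymTables d Lc) (cΛ : ℝ) :
    ∀ m : ℕ, ∃ C δ' : ℝ, 0 < δ' ∧ VertexFamily (MCompInf tabs cΛ (m + 1)) (Lc ^ (m + 1)) C δ' := by
  intro m
  obtain ⟨CH, hH⟩ := tabs.hH 1 zero_le_one
  have hCq : 0 ≤ (cBH d Lc + cDsh d Lc) * Real.exp (1 * (((d : ℝ) + 1) * (2 * Lc))) :=
    mul_nonneg (add_nonneg (cBH_nonneg d Lc) (cDsh_nonneg d Lc)) (Real.exp_pos _).le
  have hq : ∀ (ρ : Fin (d + 1)) (w : Site (d + 1)) (κ : Fin (d + 1)) (u : Site (d + 1)),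
      |qSym Lc ρ w κ u| ≤ (cBH d Lc + cDsh d Lc) * Real.exp (1 * (((d : ℝ) + 1) * (2 * Lc))) * Real.exp (-1 * l1 (u - (Lc : ℤ) • w)) :=
    fun ρ w κ u => abs_qSym_le zero_le_one ρ w κ u
  obtain ⟨C, δ', hδ', hV⟩ := vertexFamily_HComp hq hCq one_pos hH lamPerfect m
  exact ⟨|cΛ| * C, δ', hδ', fun ρ w => biLoc_smul cΛ (hV ρ w)⟩

/-- [our object — bookkeeping] **THE RECORD'S COMPOSITE MIXED TABLES ARE LOCAL FIELD–MULTIPLIER TABLES AT THEIR OWN BLOCKING, UNCONDITIONALLY**: for an2's `SymTables` and every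
`cΛ`, `m`, `∃ C δ′, 0 < δ′ ∧ LocStencilFM (Lc^(m+1)) (M2CompInf tabs cΛ (m+1)) C δ′` (FILE D4's `locStencilFM_M2Comp` fed with `abs_qSym_le` and `tabs.hH` at the rate of `tabs.hmix`).
Discharges nothing of the END by itself (the (M₂)-letter of `WtInf`). -/
theorem locStencilFM_M2CompInf (tabs : SymTables d Lc) (cΛ : ℝ) :
    ∀ m : ℕ, ∃ C δ' : ℝ, 0 < δ' ∧ LocStencilFM (Lc ^ (m + 1)) (M2CompInf tabs cΛ (m + 1)) C δ' := by
  intro m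
  obtain ⟨Cm, δm, hδm, hmix⟩ := tabs.hmix
  obtain ⟨CH, hH⟩ := tabs.hH δm hδm.le
  have hCq : 0 ≤ (cBH d Lc + cDsh d Lc) * Real.exp (δm * (((d : ℝ) + 1) * (2 * Lc))) :=
    mul_nonneg (add_nonneg (cBH_nonneg d Lc) (cDsh_nonneg d Lc)) (Real.exp_pos _).le
  have hq : ∀ (ρ : Fin (d + 1)) (w : Site (d + 1)) (κ : Fin (d + 1)) (u : Site (d + 1)),
      |qSym Lc ρ w κ u| ≤ (cBH d Lc + cDsh d Lc) * Real.exp (δm * (((d : ℝ) + 1) * (2 * Lc))) * Real.exp (-δm * l1 (u - (Lc : ℤ) • w)) :=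
    fun ρ w κ u => abs_qSym_le hδm.le ρ w κ u
  exact locStencilFM_M2Comp hq hCq hδm hH hmix lamPerfect cΛ m

end Summit.QuantumFields.BalabanUV.Beta.FP.PerfectSecondOrderTablesLetters

end
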